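import Literature.Analysis.ValidatedNumerics.CodeListKrawczykCertificate
import HarnessLib

/-!
# Krawczyk's test with a SUPPLIED interval Jacobian: the certificate split into per-row obligations

Topic `Literature/Analysis/ValidatedNumerics`.  Sequel of `CodeListKrawczykCertificate.lean` (eng-cap-3): there ONE
Boolean `CodeListKrawczykCert.check` recomputes the whole interval Jacobian `[J] = F'(X)` (the `n²` natural
extensions of the derived code lists) inside a single kernel evaluation — measured cost ≈ `n^{2.8}·|row|`
(464 s at `n = 40`, 1 468 s at `n = 60` with 60-term cubic rows), so systems with `n ≳ 80` or large rows do not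
fit ONE `native_decide`.  Here the interval Jacobian is SUPPLIED as data `jac : Fin n → Fin n → Iv` and the
certificate is accepted from

* `rowOK i` (one Boolean PER ROW `i`, provable in its own file): the natural extensions of `fᵢ` at `[x̃,x̃]` and
  over `X` answer, and for every `k` the natural extension of `∂ₖfᵢ` over `X` answers and is CONTAINED in the
  supplied `jac i k` (Moore 1979 §4.3 (4.21): any enclosure of the range of `∂ₖfᵢ` over `X` will do);
* `coreCheck` (one Boolean): `x̃ ∈ int X` and `K(X, x̃) ⊆ int X` with `K` computed from the SUPPLIED `[J]`
  (Moore (5.6)–(5.7); Neumaier (13), Thm 5.1.8 (iii)) — cost `n³` interval products + `n` point evaluations.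

Soundness (`sound`, `existsUnique_zero`, `zero_mem_krawczykBox`, `jacobian_det_ne_zero`) is Neumaier's
Thm 5.1.8 = `KrawczykTest_holds` of `KrawczykOperatorHolds.lean` exactly as in the parent file, with the ONE
extra remark that a matrix interval CONTAINING the interval Jacobian is still a Lipschitz matrix for `f` on `X`
(Neumaier Cor. 5.1.5 only uses `f'(y) ∈ [J]` for `y ∈ X`).

Sources typed: R. E. Moore, *Methods and Applications of Interval Analysis* (SIAM 1979) §5.2 Thms 5.3–5.4,
eq. (5.6)–(5.7), §4.3 (4.21) [Moore1979]; A. Neumaier, *Interval Methods for Systems of Equations* (CUP 1990)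
§5.1 eq. (13), Thm 5.1.8, Cor. 5.1.5, §3.1 Prop. 3.1.2 [Neumaier1991].  Use: the CERT-FORMAT-K2 pre-registration
of the NS ladder's item 20428 (a real point of a large polynomial system, `n ≈ 60–230`), where the `n` row
obligations are landed as separate computational files and the core check stays small.  No Navier–Stokes content.

AI-produced formalisation (H21, seat ns-k2-port-2 g2, 2026-08-28).
-/

set_option autoImplicit false

noncomputable section

open Set NonemptyInterval Matrix
open Literature.Analysis.ODE Literature.Analysis.ODE.FExpr
open Literature.Analysis.ValidatedNumerics.ITaylor

namespace Literature.Analysis.ValidatedNumerics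

variable {n : ℕ}

/-- `some`-ness of an option pins it to its default-free value. [folklore] -/
private theorem eq_some_getD' {α : Type*} {o : Option α} (d : α) (h : o.isSome = true) :
    o = some (o.getD d) := by
  cases o with
  | none => exact absurd h (by simp)
  | some a => rfl

/-- A **Krawczyk certificate with a supplied interval Jacobian**: the data of `CodeListKrawczykCert`
(system, box `X`, point `x̃`, preconditioner `C`, precision) plus the interval matrix `jac ⊇ F'(X)` claimed
by the producer and checked row by row. [cite: Moore1979, §5.2 eq. (5.6) and Thm 5.3]
[cite: Neumaier1991, §5.1 eq. (13)] -/
structure CodeListKrawczykDataCert (n : ℕ) where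
  /-- The system, one code list per component. -/
  system : Fin n → FExpr n
  /-- The box `X`. -/
  box : Fin n → Iv
  /-- The point `x̃ ∈ int X`. -/
  center : Fin n → ℚ
  /-- The point preconditioning matrix `C ≈ (mid F'(X))⁻¹`. -/
  precond : Matrix (Fin n) (Fin n) ℚ
  /-- Precision parameters of the natural interval extensions. -/
  cfg : SeedCfg
  /-- The SUPPLIED interval Jacobian `[J]`, to contain the natural extensions `∂ₖFᵢ(X)`. -/
  jac : Fin n → Fin n → Iv

namespace CodeListKrawczykDataCert

variable (c : CodeListKrawczykDataCert n)

/-- The natural extension of `fᵢ` over the point box `[x̃, x̃]`. [cite: Moore1979, §5.2 eq. (5.6) (the term f(y))] -/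
def valOpt (i : Fin n) : Option Iv := evalBox c.cfg (c.system i) (pointBox c.center)

/-- The natural extension of `fᵢ` over `X` (domain certificate). [cite: Moore1979, §4.3 eq. (4.20)] -/
def rangeOpt (i : Fin n) : Option Iv := evalBox c.cfg (c.system i) c.box

/-- The natural extension `D_k Fᵢ(X)` of the derived code list. [cite: Moore1979, §4.3 eq. (4.21)] -/
def jacOpt (i k : Fin n) : Option Iv := evalBox c.cfg ((c.system i).pderiv k) c.box

/-- Entry `(i,k)` is certified: `D_k Fᵢ(X)` answers and lies inside the supplied `jac i k`.
[cite: Moore1979, §4.3 eq. (4.21)] [cite: Neumaier1991, Cor. 5.1.5] -/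
def jacOK (i k : Fin n) : Bool :=
  match c.jacOpt i k with
  | none => false
  | some I => decide ((c.jac i k).fst ≤ I.fst) && decide (I.snd ≤ (c.jac i k).snd)

/-- **THE PER-ROW OBLIGATION** (one `native_decide` each, any number of files): the natural extensions of row
`i` answer and its `n` Jacobian entries lie in the supplied intervals. [cite: Moore1979, §4.3 eq. (4.21)] -/
def rowOK (i : Fin n) : Bool :=
  (c.valOpt i).isSome && (c.rangeOpt i).isSome && (List.finRange n).all fun k => c.jacOK i k

/-- `F([x̃, x̃]) ∋ f(x̃)`. [cite: Moore1979, §5.2 eq. (5.6) (the term f(y))] -/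
def valBox : Fin n → Iv := fun i => (c.valOpt i).getD 0

/-- `I − C·[J]` on the SUPPLIED `[J]`. [cite: Moore1979, §5.2 eq. (5.6) (the factor I − Y F'(X))]
[cite: Neumaier1991, §3.1 Proposition 3.1.2 (6)] -/
def slopeBox : Fin n → Fin n → Iv :=
  fun i k => pointMat 1 i k + imatmulQ (pointMat (-c.precond)) c.jac i k

/-- `x̃ − C·F([x̃, x̃])`. [cite: Moore1979, §5.2 eq. (5.6) (the term y − Y f(y))] -/
def residualBox : Fin n → Iv :=
  fun i => pure (c.center i) + imatvecQ (pointMat (-c.precond)) c.valBox i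

/-- **The Krawczyk box** `K(X, x̃) = x̃ − C f(x̃) + (I − C [J])(X − x̃)` on the supplied `[J]`.
[cite: Moore1979, §5.2 eq. (5.6)] [cite: Neumaier1991, §5.1 eq. (13)] -/
def krawczykBox : Fin n → Iv := mvBoxQ c.residualBox c.slopeBox c.box c.center

/-- **THE CORE CHECK**: `x̃ ∈ int X` and `K(X, x̃) ⊆ int X` (cost `n³`, independent of the row sizes).
[cite: Moore1979, §5.2 eq. (5.7) and Thm 5.4] [cite: Neumaier1991, Thm 5.1.8 (iii)] -/
def coreCheck : Bool :=
  strictIn (pointBox c.center) c.box && strictIn c.krawczykBox c.box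

/-- The supplied interval Jacobian as a set of real matrices `[J̲, J̄]`. [cite: Neumaier1991, §5.1 eq. (6)] -/
def lipMat : Set (Matrix (Fin n) (Fin n) ℝ) :=
  matrixIcc (fun i k => (((c.jac i k).fst : ℚ) : ℝ)) (fun i k => (((c.jac i k).snd : ℚ) : ℝ))

/-- The exactly-rendered Krawczyk set `K(x, x̃)` for this certificate's data. [cite: Neumaier1991, §5.1 eq. (13)] -/
def kSet : Set (Fin n → ℝ) :=
  krawczykSet c.lipMat (castQMat c.precond) (fieldFun c.system) (fun l => (c.center l : ℝ))
    (boxSet (castBox c.box))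

/-! ### Soundness -/

/-- Unpacking a certified row. [cite: Moore1979, §4.3 eq. (4.21)] -/
theorem rowOK_spec {i : Fin n} (h : c.rowOK i = true) (k : Fin n) :
    c.valOpt i = some (c.valBox i) ∧ (c.rangeOpt i).isSome = true ∧
      ∃ I, c.jacOpt i k = some I ∧ (c.jac i k).fst ≤ I.fst ∧ I.snd ≤ (c.jac i k).snd := by
  simp only [rowOK, Bool.and_eq_true] at h
  obtain ⟨⟨h1, h2⟩, h3⟩ := h
  have hk := List.all_eq_true.1 h3 k (List.mem_finRange k)
  refine ⟨eq_some_getD' 0 h1, h2, ?_⟩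
  unfold jacOK at hk
  cases hI : c.jacOpt i k with
  | none => rw [hI] at hk; exact absurd hk (by simp)
  | some I =>
    rw [hI] at hk
    simp only [Bool.and_eq_true, decide_eq_true_eq] at hk
    exact ⟨I, rfl, hk.1, hk.2⟩

/-- The box lies in the natural domain of the system. [cite: Moore1979, §3.4 (last paragraph)] -/
theorem box_subset_dom (hr : ∀ i, c.rowOK i = true) : boxSet (castBox c.box) ⊆ domOpens c.system := by
  intro y hy
  rw [SetLike.mem_coe, mem_domOpens]
  intro i
  obtain ⟨I, hI⟩ := Option.isSome_iff_exists.1 (c.rowOK_spec (hr i) i).2.1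
  exact (evalBox_sound hI hy).1

/-- `f(x̃) ∈ F([x̃, x̃])`. [cite: Moore1979, §5.2 eq. (5.6) (the term f(y))] -/
theorem value_mem_valBox (hr : ∀ i, c.rowOK i = true) (i : Fin n) :
    fieldFun c.system (fun l => (c.center l : ℝ)) i ∈ (c.valBox i).ratCast ℝ :=
  (evalBox_sound (c.rowOK_spec (hr i) i).1 (ratVec_mem_pointBox c.center)).2

/-- **The supplied interval Jacobian encloses the Jacobian** on `X` (natural extension ⊆ supplied entry).
[cite: Moore1979, §4.3 eq. (4.21)] [cite: Neumaier1991, Prop. 5.1.4] -/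
theorem fderiv_apply_mem_jac (hr : ∀ i, c.rowOK i = true) {y : Fin n → ℝ}
    (hy : y ∈ boxSet (castBox c.box)) (i k : Fin n) :
    fderiv ℝ (fieldFun c.system) y (Pi.single k 1) i ∈ castMat c.jac i k := by
  obtain ⟨I, hI, hlo, hhi⟩ := (c.rowOK_spec (hr i) k).2.2
  rw [castMat_apply, fderiv_fieldFun_apply_single c.system (c.box_subset_dom hr hy) i k, mem_ratCast_iff]
  have h := (evalBox_sound hI hy).2
  rw [mem_ratCast_iff] at h
  exact ⟨le_trans (by exact_mod_cast hlo) h.1, le_trans h.2 (by exact_mod_cast hhi)⟩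

/-- The system is differentiable at every point of the box. [cite: Moore1979, §3.4 (last paragraph)] -/
theorem hasFDerivAt_fieldFun (hr : ∀ i, c.rowOK i = true) {y : Fin n → ℝ}
    (hy : y ∈ boxSet (castBox c.box)) :
    HasFDerivAt (fieldFun c.system) (fderiv ℝ (fieldFun c.system) y) y :=
  have hyΩ := c.box_subset_dom hr hy
  ((((contDiffOn_fieldFun c.system).differentiableOn (by simp)) y hyΩ).differentiableAt
    ((domOpens c.system).isOpen.mem_nhds hyΩ)).hasFDerivAt

/-- Membership in `[J̲, J̄]` is entrywise membership. [cite: Neumaier1991, §3.1 (interval matrices)] -/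
theorem mem_lipMat_iff {M : Matrix (Fin n) (Fin n) ℝ} :
    M ∈ c.lipMat ↔ ∀ i k, M i k ∈ castMat c.jac i k := by
  simp only [lipMat, matrixIcc, Set.mem_setOf_eq, castMat_apply, mem_ratCast_iff]

/-- **The supplied interval Jacobian is a Lipschitz matrix for `f` on `X`.** [cite: Neumaier1991, Cor. 5.1.5] -/
theorem isLipschitzSetOn_lipMat (hr : ∀ i, c.rowOK i = true) :
    IsLipschitzSetOn c.lipMat (fieldFun c.system) (boxSet (castBox c.box)) :=
  isLipschitzSetOn_matrixIcc_of_hasFDerivWithinAt (convex_boxSet _)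
    (fun y hy => (c.hasFDerivAt_fieldFun hr hy).hasFDerivWithinAt)
    fun y hy i k => by
      have h := c.fderiv_apply_mem_jac hr hy i k
      rw [castMat_apply, mem_ratCast_iff] at h
      exact h

/-- Unpacking the core check. [cite: Moore1979, §5.2 Thm 5.4] -/
theorem coreCheck_spec (hc : c.coreCheck = true) :
    strictIn (pointBox c.center) c.box = true ∧ strictIn c.krawczykBox c.box = true := by
  simpa only [coreCheck, Bool.and_eq_true] using hc

/-- `x̃ ∈ int X`. [cite: Neumaier1991, Thm 5.1.8 (iii) (hypothesis x̃ ∈ int x)] -/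
theorem center_mem_interior (hc : c.coreCheck = true) :
    (fun l => (c.center l : ℝ)) ∈ interior (boxSet (castBox c.box)) :=
  boxSet_subset_interior_of_strictIn (c.coreCheck_spec hc).1 (ratVec_mem_pointBox c.center)

/-- `x̃ ∈ X`. [cite: Moore1979, §5.2 Thm 5.3 (hypothesis y ∈ X)] -/
theorem center_mem_box (hc : c.coreCheck = true) :
    (fun l => (c.center l : ℝ)) ∈ boxSet (castBox c.box) :=
  interior_subset (c.center_mem_interior hc)

/-- The cast of the negated preconditioner. [folklore] -/
private theorem castQMat_neg'' (C : Matrix (Fin n) (Fin n) ℚ) : castQMat (-C) = -castQMat C := by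
  ext i l
  simp only [castQMat_apply, Matrix.neg_apply, Rat.cast_neg]

/-- **The computed Krawczyk box encloses the Krawczyk set** (inclusion isotonicity, row by row; verbatim the
parent file's argument on the supplied `[J]`). [cite: Neumaier1991, §3.1 Proposition 3.1.2 (6)] [cite: Moore1979, §5.2 eq. (5.6)] -/
theorem kSet_subset_krawczykBox (hr : ∀ i, c.rowOK i = true) : c.kSet ⊆ boxSet (castBox c.krawczykBox) := by
  intro z hz
  rw [mem_boxSet_iff]
  intro i
  obtain ⟨B, hB, y, hy, hzi⟩ := hz i
  have hp : (fun l => (c.center l : ℝ)) - castQMat c.precond *ᵥ fieldFun c.system (fun l => (c.center l : ℝ))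
      ∈ boxSet (castBox c.residualBox) := by
    rw [mem_boxSet_iff]
    intro j
    rw [sub_eq_add_neg, ← Matrix.neg_mulVec, ← castQMat_neg'']
    simp only [castBox_apply, residualBox, QMvPoly.ratCast_add, ratCast_pure, Pi.add_apply]
    refine add_mem_add' (mem_pure_self _) ?_
    have h := mulVec_mem_imatvecQ (fun a b => castQMat_mem_pointMat (-c.precond) a b)
      (fun l => by rw [castBox_apply]; exact c.value_mem_valBox hr l) j
    rwa [castBox_apply] at h
  have hM : ∀ a b, (1 - B) a b ∈ castMat c.slopeBox a b := by
    intro a b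
    obtain ⟨M, hM, hab⟩ := hB a b
    rw [Matrix.sub_apply, hab, sub_eq_add_neg, ← Matrix.neg_apply, ← Matrix.neg_mul, ← castQMat_neg'',
      castMat_apply]
    simp only [slopeBox, QMvPoly.ratCast_add]
    refine add_mem_add' ?_ ?_
    · have h1 := castQMat_mem_pointMat (1 : Matrix (Fin n) (Fin n) ℚ) a b
      rw [castQMat_one, castMat_apply] at h1
      exact h1
    · have h2 := mul_mem_imatmulQ (fun i k => castQMat_mem_pointMat (-c.precond) i k)
        ((c.mem_lipMat_iff).1 hM) a b
      rwa [castMat_apply] at h2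
  have hmv := meanValue_mem_mvBoxQ (m := c.center) hp hM hy
  have heq : (fun l => (c.center l : ℝ)) - castQMat c.precond *ᵥ fieldFun c.system (fun l => (c.center l : ℝ))
        - (B - 1) *ᵥ (y - fun l => (c.center l : ℝ)) =
      (fun l => (c.center l : ℝ)) - castQMat c.precond *ᵥ fieldFun c.system (fun l => (c.center l : ℝ))
        + (1 - B) *ᵥ (y - fun l => (c.center l : ℝ)) := by
    rw [sub_eq_add_neg (_ - _), ← Matrix.neg_mulVec, neg_sub]
  rw [hzi, heq]
  exact (mem_boxSet_iff.1 hmv) i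

/-- The lower endpoint matrix belongs to `[J̲, J̄]`. [cite: Neumaier1991, §3.1 (interval matrices)] -/
theorem loMat_mem_lipMat : (fun i k => (((c.jac i k).fst : ℚ) : ℝ)) ∈ c.lipMat :=
  fun i k => ⟨le_rfl, Rat.cast_le.2 (c.jac i k).fst_le_snd⟩

/-- The Krawczyk set is non-empty. [cite: Neumaier1991, Thm 5.1.8 (hypothesis ∅ ≠ x')] -/
theorem kSet_nonempty (hc : c.coreCheck = true) : c.kSet.Nonempty :=
  ⟨_, fun _ => ⟨castQMat c.precond * (Matrix.of fun i k => (((c.jac i k).fst : ℚ) : ℝ)),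
    fun _ _ => ⟨_, c.loMat_mem_lipMat, rfl⟩, _, c.center_mem_box hc, rfl⟩⟩

/-- `K(X, x̃) ⊆ int X` for the Krawczyk set. [cite: Neumaier1991, Thm 5.1.8 (iii)] [cite: Moore1979, §5.2 eq. (5.7)] -/
theorem kSet_subset_interior (hr : ∀ i, c.rowOK i = true) (hc : c.coreCheck = true) :
    c.kSet ⊆ interior (boxSet (castBox c.box)) :=
  (c.kSet_subset_krawczykBox hr).trans (boxSet_subset_interior_of_strictIn (c.coreCheck_spec hc).2)

/-- **SOUNDNESS OF THE SPLIT KRAWCZYK CERTIFICATE**: all row obligations + the core check ⇒ the supplied `[J]` is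
regular, `f` has EXACTLY ONE zero in `X`, and every zero of `f` in `X` lies in `K(X, x̃)`.
[cite: Neumaier1991, Thm 5.1.8] [cite: Moore1979, §5.2 Thms 5.3–5.4] -/
theorem sound (hr : ∀ i, c.rowOK i = true) (hc : c.coreCheck = true) :
    (∀ M ∈ c.lipMat, M.det ≠ 0) ∧
    (∃! z, z ∈ boxSet (castBox c.box) ∧ fieldFun c.system z = 0) ∧
    (∀ z ∈ boxSet (castBox c.box), fieldFun c.system z = 0 → z ∈ boxSet (castBox c.krawczykBox)) := by
  have h := KrawczykTest_holds n (fieldFun c.system) (boxSet (castBox c.box))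
    (fun i k => (((c.jac i k).fst : ℚ) : ℝ)) (fun i k => (((c.jac i k).snd : ℚ) : ℝ))
    (castQMat c.precond) (boxLo (castBox c.box)) (boxHi (castBox c.box)) (fun l => (c.center l : ℝ))
    (exists_lipschitzOnWith_of_isLipschitzSetOn (c.isLipschitzSetOn_lipMat hr))
    (c.isLipschitzSetOn_lipMat hr) (fun _ hy => hy) (c.center_mem_interior hc) (c.kSet_nonempty hc)
    (c.kSet_subset_interior hr hc)
  exact ⟨h.1, h.2.1, fun z hz h0 => c.kSet_subset_krawczykBox hr (h.2.2 z hz h0)⟩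

/-- **Exactly one solution of the system in the box.** [cite: Moore1979, §5.2 Thm 5.4] [cite: Neumaier1991, Thm 5.1.8 (iii)] -/
theorem existsUnique_zero (hr : ∀ i, c.rowOK i = true) (hc : c.coreCheck = true) :
    ∃! z, z ∈ boxSet (castBox c.box) ∧ ∀ i, (c.system i).eval z = 0 := by
  have h := (c.sound hr hc).2.1
  simp only [funext_iff] at h
  exact h

/-- **Every solution in the box lies in the Krawczyk box.** [cite: Moore1979, §5.2 Thm 5.3] [cite: Neumaier1991, Thm 5.1.8 (i)] -/
theorem zero_mem_krawczykBox (hr : ∀ i, c.rowOK i = true) (hc : c.coreCheck = true) {z : Fin n → ℝ}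
    (hz : z ∈ boxSet (castBox c.box)) (h0 : ∀ i, (c.system i).eval z = 0) : z ∈ boxSet (castBox c.krawczykBox) :=
  (c.sound hr hc).2.2 z hz (funext h0)

/-- All row obligations as one `List.all` (when a single file can afford it). [cite: Moore1979, §4.3 eq. (4.21)] -/
theorem rowOK_all_iff : ((List.finRange n).all fun i => c.rowOK i) = true ↔ ∀ i, c.rowOK i = true := by
  rw [List.all_eq_true]
  exact ⟨fun h i => h i (List.mem_finRange i), fun h i _ => h i⟩

end CodeListKrawczykDataCert

/-! ### Kernel example: Moore's system (5.11) with the interval Jacobian supplied as data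

`f₁ = x₁² + x₂² − 1`, `f₂ = x₁ − x₂²` on `X = ([.5,.8],[.6,.9])`: `F'(X) = (2X₁, 2X₂; 1, −2X₂) = ([1,1.6],[1.2,1.8]; [1,1],[−1.8,−1.2])`
— supplied slightly widened; the two row obligations and the core check are three separate `decide`s. -/

/-- Moore's example with a supplied (widened) interval Jacobian. [cite: Moore1979, §5.2 eqs. (5.11)–(5.13)] -/
def mooreData : CodeListKrawczykDataCert 2 where
  system := mooreSystem
  box := ![⟨(5 / 10, 8 / 10), by decide +kernel⟩, ⟨(6 / 10, 9 / 10), by decide +kernel⟩]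
  center := ![65 / 100, 75 / 100]
  precond := !![43 / 100, 43 / 100; 29 / 100, -37 / 100]
  cfg := ⟨40, 30, 12, 3, 0⟩
  jac := fun i k => (![![(⟨(99 / 100, 161 / 100), by decide +kernel⟩ : Iv), ⟨(119 / 100, 181 / 100), by decide +kernel⟩],
    ![(⟨(1, 1), by decide +kernel⟩ : Iv), ⟨(-181 / 100, -119 / 100), by decide +kernel⟩]] i) k

/-- Row 0 of Moore's example is certified against the supplied Jacobian. [cite: Moore1979, §4.3 eq. (4.21)] -/
theorem mooreData_row0 : mooreData.rowOK 0 = true := by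
  decide +kernel

/-- Row 1 likewise. [cite: Moore1979, §4.3 eq. (4.21)] -/
theorem mooreData_row1 : mooreData.rowOK 1 = true := by
  decide +kernel

/-- The core check of Moore's example on the supplied Jacobian. [cite: Moore1979, §5.2 eq. (5.7)] -/
theorem mooreData_core : mooreData.coreCheck = true := by
  decide +kernel

/-- **Exactly one solution of (5.11) in the box**, from the three split Booleans. [cite: Moore1979, §5.2 Thm 5.4] -/
theorem mooreData_existsUnique :
    ∃! z, z ∈ boxSet (castBox mooreData.box) ∧ ∀ i, (mooreData.system i).eval z = 0 :=
  mooreData.existsUnique_zero (fun i => by fin_cases i <;> first | exact mooreData_row0 | exact mooreData_row1)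
    mooreData_core

end Literature.Analysis.ValidatedNumerics

end
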